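import Summits.CriticalPhenomena.PercolationContinuityZ3.Theorems.Transplant.SqShadowVRouting
import Summits.CriticalPhenomena.PercolationContinuityZ3.Theorems.Transplant.SqShadowEq12
import HarnessLib

/-!
# SQUARE SHADOWS — THE ROUTING NODE FROM LOCAL / SHAPED LINKAGE and the end of the square chain: `LocalLinkage → SqLocatedSurgeries → SqGluing → θ_v(p_c) = 0`
# (square twin of «HexShadowLinkageNode» / «HexShadowVLinkageNode»)

builds on p205010 (kernel theorem, internal audit signed; external expert review pending) — NOT used in this file.  Lane `prim-bschramm`, seat `prim-bschramm-p2` (gen 42; class C1b;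
memo `HOME/bschramm/P2-LATTICES.md` §148); helper file (`--supports stmt-CriticalPhenomena-4575 --as helper`).
* §1 **`sqLocatedSurgeries_of_localLinkage`** / **`sqLocatedSurgeries_of_shapedLinkage`**: located surgeries of radius `3` at all but `N₀ = 1429` points of `U(ω)` (the exceptional sets
  `X₁`, `X₂`, `zBad` and the `3`-neighbourhood of the end of `γ_min(ω)` lie in five lattice squares of radii `3, 4, 12, 12, 3`), for all data in range with `m ≥ 13`; hence
  **`sqGluing_of_localLinkage`**, **`sqGluing_of_shapedLinkage`**;
* §3 **`theta_criticalProb_eq_zero_of_localLinkage`**, **`theta_criticalProb_eq_zero_of_shapedLinkage`**: a CONNECTED graph with a square shadow, a.s. uniqueness of the infinite cluster at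
  every density and the local routing node dies at its own critical point at every vertex — Duminil-Copin–Sidoravicius–Tassion's Theorem 1 for an abstract square shadow
  (`D₄ ⋉ ℤ²`-symmetric films), everything but the instance's local linkage PROVED in the tree.
[cite: DuminilCopinSidoraviciusTassion2016, Thm. 1, Lemma 6 and §2.3 (proof of Fact 2, pp. 6–7)] [cite: BenjaminiSchramm1996, Conj. 4 / Question 3]
-/

noncomputable section

namespace Summit.CriticalPhenomena.PercolationContinuityZ3.Theorems.Transplant

open MeasureTheory Literature.Probability.Percolation Literature.Probability.LatticeModels SimpleGraph Filter
open scoped Classical Topology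

namespace SqShadow

variable {V : Type} {G : SimpleGraph V} (Ψ : SqShadow G) [Countable V]

/-! ## §1 The node from local linkage -/

/-- Counting in a filtered finset through a bounded square. [folklore] -/
private theorem card_filter_le_of_subset_sqBall (T : Finset (Site 2)) (p : Site 2 → Prop) (q : Site 2) (R : ℕ)
    (h : ∀ z ∈ T, p z → z ∈ sqBall q R) : (T.filter p).card ≤ (2 * R + 1) ^ 2 := by
  refine (Finset.card_le_card ?_).trans (card_filter_mem_sqBall_le T q R)
  intro z hz
  rw [Finset.mem_filter] at hz ⊢
  exact ⟨hz.1, h z hz.1 hz.2⟩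

/-- **THE ROUTING NODE FROM LOCAL LINKAGE** (DST 2016, §2.3, proof of Fact 2, with the instance's "three disjoint paths" in the swap-pair form
`LocalLinkage`): located surgery outputs of radius `3` exist at all but at most `1429` points of `U(ω)`, for all data in range with `m ≥ 13` and every lattice
configuration `ω ∈ 𝒳`. [cite: DuminilCopinSidoraviciusTassion2016, §2.3 (proof of Fact 2, pp. 6–7)] -/
theorem sqLocatedSurgeries_of_localLinkage (hL : Ψ.LocalLinkage) : Ψ.SqLocatedSurgeries := by
  refine ⟨3, (2 * 3 + 1) ^ 2 + (2 * 4 + 1) ^ 2 + ((2 * 12 + 1) ^ 2 + (2 * 12 + 1) ^ 2) + (2 * 3 + 1) ^ 2, 13, fun Γ hm hΓ ω hω hX => ?_⟩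
  have hA : ω ∈ Ψ.evA Γ := hX.1.1.1
  obtain ⟨hγO, -⟩ := Ψ.γmin_spec Γ hA
  set v₀ : V := (Ψ.γmin Γ ω).getLast hγO.ne_nil with hv₀
  have hlast : (Ψ.γmin Γ ω).getLast? = some v₀ := List.getLast?_eq_some_getLast hγO.ne_nil
  set T : Finset (Site 2) := (Ψ.U_finite Γ ω).toFinset with hT
  have hTU : ∀ z, z ∈ T ↔ z ∈ Ψ.U Γ ω := fun z => Set.Finite.mem_toFinset _
  set good : Site 2 → Prop := fun z => z ∉ Ψ.X₁ Γ ∧ z ∉ Ψ.X₂ Γ ∧ z ∉ Ψ.zBad Γ ∧ ∀ v ∈ (Ψ.γmin Γ ω).getLast?, z ∉ sqBall (Ψ.sh v) 3 with hgood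
  have hbs : ∀ z ∈ T, z ∈ Ψ.big Γ ∧ z ∈ Ψ.small Γ := by
    intro z hz
    obtain ⟨hzs, ⟨g, hg, hgz⟩, -⟩ := (hTU z).1 hz
    exact ⟨hgz ▸ hγO.subset g hg, hzs⟩
  refine ⟨T.filter good, fun z hz => (hTU z).1 (Finset.mem_filter.1 hz).1, ?_, ?_⟩
  · -- counting the excluded points
    rw [Set.ncard_eq_toFinset_card _ (Ψ.U_finite Γ ω), ← Finset.card_filter_add_card_filter_not good]
    change (T.filter good).card + (T.filter fun z => ¬good z).card ≤ (T.filter good).card + _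
    have hsub : (T.filter fun z => ¬good z) ⊆ T.filter (· ∈ Ψ.X₁ Γ) ∪ T.filter (· ∈ Ψ.X₂ Γ) ∪
        (T.filter (· ∈ sqBall (Ψ.centre + ![3 * (Γ.m : ℤ), Ψ.period * Γ.s - Γ.a]) 12) ∪
          T.filter (· ∈ sqBall (Ψ.centre + ![3 * (Γ.m : ℤ), Ψ.period * Γ.s + Γ.a]) 12)) ∪ T.filter (· ∈ sqBall (Ψ.sh v₀) 3) := by
      intro z hz
      rw [Finset.mem_filter] at hz
      obtain ⟨hzT, hng⟩ := hz
      simp only [hgood, not_and_or, not_not, not_forall, exists_prop] at hng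
      simp only [Finset.mem_union, Finset.mem_filter]
      rcases hng with h | h | h | ⟨v, hv, h⟩
      · exact Or.inl (Or.inl (Or.inl ⟨hzT, h⟩))
      · exact Or.inl (Or.inl (Or.inr ⟨hzT, h⟩))
      · rcases zBad_subset h with h' | h'
        · exact Or.inl (Or.inr (Or.inl ⟨hzT, h'⟩))
        · exact Or.inl (Or.inr (Or.inr ⟨hzT, h'⟩))
      · right
        rw [hlast] at hv
        simp only [Option.mem_def, Option.some.injEq] at hv
        subst hv
        exact ⟨hzT, h⟩
    have h1 : (T.filter (· ∈ Ψ.X₁ Γ)).card ≤ (2 * 3 + 1) ^ 2 :=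
      card_filter_le_of_subset_sqBall T _ _ 3 fun z hz hX => X₁_subset hX (hbs z hz).1 (hbs z hz).2
    have h2 : (T.filter (· ∈ Ψ.X₂ Γ)).card ≤ (2 * 4 + 1) ^ 2 :=
      card_filter_le_of_subset_sqBall T _ _ 4 fun z hz hX => X₂_subset hX (hbs z hz).1
    have h3 : (T.filter (· ∈ sqBall (Ψ.centre + ![3 * (Γ.m : ℤ), Ψ.period * Γ.s - Γ.a]) 12)).card ≤ (2 * 12 + 1) ^ 2 :=
      card_filter_le_of_subset_sqBall T _ _ 12 fun z _ h => h
    have h4 : (T.filter (· ∈ sqBall (Ψ.centre + ![3 * (Γ.m : ℤ), Ψ.period * Γ.s + Γ.a]) 12)).card ≤ (2 * 12 + 1) ^ 2 :=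
      card_filter_le_of_subset_sqBall T _ _ 12 fun z _ h => h
    have h5 : (T.filter (· ∈ sqBall (Ψ.sh v₀) 3)).card ≤ (2 * 3 + 1) ^ 2 := card_filter_le_of_subset_sqBall T _ _ 3 fun z _ h => h
    have := (Finset.card_le_card hsub).trans ((Finset.card_union_le _ _).trans (add_le_add ((Finset.card_union_le _ _).trans (add_le_add
      ((Finset.card_union_le _ _).trans (add_le_add h1 h2)) ((Finset.card_union_le _ _).trans (add_le_add h3 h4)))) h5))
    omega
  · -- the surgery at a good point
    intro z hz
    obtain ⟨hzT, hg⟩ := Finset.mem_filter.1 hz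
    obtain ⟨sg, hsg⟩ := exists_surgery_of_localLinkage hL hΓ hm hω hX ((hTU z).1 hzT) hg.1 hg.2.1 hg.2.2.1 hg.2.2.2
    exact ⟨sg.newConfig, sg.surgOut hX hsg⟩

/-- **THE SQUARE GLUING LEMMA FROM LOCAL LINKAGE** (all of DST §2.3 is proved generically; the instance supplies only `LocalLinkage`).
[cite: DuminilCopinSidoraviciusTassion2016, Lemma 6 and §2.3] -/
theorem sqGluing_of_localLinkage (hL : Ψ.LocalLinkage) : Ψ.SqGluing := Ψ.sqGluing_of_locatedSurgeries (Ψ.sqLocatedSurgeries_of_localLinkage hL)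

/-- **THE ROUTING NODE FROM SHAPED LINKAGE** (DST 2016, §2.3, proof of Fact 2, with the instance's "three disjoint paths" in the shaped swap-pair form
`ShapedLinkage 3` and the vertex-set surgery): located surgery outputs of radius `3` exist at all but at most `1429` points of `U(ω)`, for all data in range with `m ≥ 13` and every lattice
configuration `ω ∈ 𝒳`. [cite: DuminilCopinSidoraviciusTassion2016, §2.3 (proof of Fact 2, pp. 6–7)] -/
theorem sqLocatedSurgeries_of_shapedLinkage (hL : Ψ.ShapedLinkage 3) : Ψ.SqLocatedSurgeries := by
  refine ⟨3, (2 * 3 + 1) ^ 2 + (2 * 4 + 1) ^ 2 + ((2 * 12 + 1) ^ 2 + (2 * 12 + 1) ^ 2) + (2 * 3 + 1) ^ 2, 13, fun Γ hm hΓ ω hω hX => ?_⟩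
  have hA : ω ∈ Ψ.evA Γ := hX.1.1.1
  obtain ⟨hγO, -⟩ := Ψ.γmin_spec Γ hA
  set v₀ : V := (Ψ.γmin Γ ω).getLast hγO.ne_nil with hv₀
  have hlast : (Ψ.γmin Γ ω).getLast? = some v₀ := List.getLast?_eq_some_getLast hγO.ne_nil
  set T : Finset (Site 2) := (Ψ.U_finite Γ ω).toFinset with hT
  have hTU : ∀ z, z ∈ T ↔ z ∈ Ψ.U Γ ω := fun z => Set.Finite.mem_toFinset _
  set good : Site 2 → Prop := fun z => z ∉ Ψ.X₁ Γ ∧ z ∉ Ψ.X₂ Γ ∧ z ∉ Ψ.zBad Γ ∧ ∀ v ∈ (Ψ.γmin Γ ω).getLast?, z ∉ sqBall (Ψ.sh v) 3 with hgood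
  have hbs : ∀ z ∈ T, z ∈ Ψ.big Γ ∧ z ∈ Ψ.small Γ := by
    intro z hz
    obtain ⟨hzs, ⟨g, hg, hgz⟩, -⟩ := (hTU z).1 hz
    exact ⟨hgz ▸ hγO.subset g hg, hzs⟩
  refine ⟨T.filter good, fun z hz => (hTU z).1 (Finset.mem_filter.1 hz).1, ?_, ?_⟩
  · -- counting the excluded points
    rw [Set.ncard_eq_toFinset_card _ (Ψ.U_finite Γ ω), ← Finset.card_filter_add_card_filter_not good]
    change (T.filter good).card + (T.filter fun z => ¬good z).card ≤ (T.filter good).card + _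
    have hsub : (T.filter fun z => ¬good z) ⊆ T.filter (· ∈ Ψ.X₁ Γ) ∪ T.filter (· ∈ Ψ.X₂ Γ) ∪
        (T.filter (· ∈ sqBall (Ψ.centre + ![3 * (Γ.m : ℤ), Ψ.period * Γ.s - Γ.a]) 12) ∪
          T.filter (· ∈ sqBall (Ψ.centre + ![3 * (Γ.m : ℤ), Ψ.period * Γ.s + Γ.a]) 12)) ∪ T.filter (· ∈ sqBall (Ψ.sh v₀) 3) := by
      intro z hz
      rw [Finset.mem_filter] at hz
      obtain ⟨hzT, hng⟩ := hz
      simp only [hgood, not_and_or, not_not, not_forall, exists_prop] at hng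
      simp only [Finset.mem_union, Finset.mem_filter]
      rcases hng with h | h | h | ⟨v, hv, h⟩
      · exact Or.inl (Or.inl (Or.inl ⟨hzT, h⟩))
      · exact Or.inl (Or.inl (Or.inr ⟨hzT, h⟩))
      · rcases zBad_subset h with h' | h'
        · exact Or.inl (Or.inr (Or.inl ⟨hzT, h'⟩))
        · exact Or.inl (Or.inr (Or.inr ⟨hzT, h'⟩))
      · right
        rw [hlast] at hv
        simp only [Option.mem_def, Option.some.injEq] at hv
        subst hv
        exact ⟨hzT, h⟩
    have h1 : (T.filter (· ∈ Ψ.X₁ Γ)).card ≤ (2 * 3 + 1) ^ 2 :=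
      card_filter_le_of_subset_sqBall T _ _ 3 fun z hz hX => X₁_subset hX (hbs z hz).1 (hbs z hz).2
    have h2 : (T.filter (· ∈ Ψ.X₂ Γ)).card ≤ (2 * 4 + 1) ^ 2 :=
      card_filter_le_of_subset_sqBall T _ _ 4 fun z hz hX => X₂_subset hX (hbs z hz).1
    have h3 : (T.filter (· ∈ sqBall (Ψ.centre + ![3 * (Γ.m : ℤ), Ψ.period * Γ.s - Γ.a]) 12)).card ≤ (2 * 12 + 1) ^ 2 :=
      card_filter_le_of_subset_sqBall T _ _ 12 fun z _ h => h
    have h4 : (T.filter (· ∈ sqBall (Ψ.centre + ![3 * (Γ.m : ℤ), Ψ.period * Γ.s + Γ.a]) 12)).card ≤ (2 * 12 + 1) ^ 2 :=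
      card_filter_le_of_subset_sqBall T _ _ 12 fun z _ h => h
    have h5 : (T.filter (· ∈ sqBall (Ψ.sh v₀) 3)).card ≤ (2 * 3 + 1) ^ 2 := card_filter_le_of_subset_sqBall T _ _ 3 fun z _ h => h
    have := (Finset.card_le_card hsub).trans ((Finset.card_union_le _ _).trans (add_le_add ((Finset.card_union_le _ _).trans (add_le_add
      ((Finset.card_union_le _ _).trans (add_le_add h1 h2)) ((Finset.card_union_le _ _).trans (add_le_add h3 h4)))) h5))
    omega
  · -- the surgery at a good point
    intro z hz
    obtain ⟨hzT, hg⟩ := Finset.mem_filter.1 hz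
    obtain ⟨sg, hsg⟩ := exists_vsurgery_of_shapedLinkage hL hΓ hm hω hX ((hTU z).1 hzT) hg.1 hg.2.1 hg.2.2.1 hg.2.2.2
    exact ⟨sg.newConfig, sg.surgOut hX hsg⟩

/-- **THE SQUARE GLUING LEMMA FROM SHAPED LINKAGE** (all of DST §2.3 is proved generically; the instance supplies only `ShapedLinkage 3`).
[cite: DuminilCopinSidoraviciusTassion2016, Lemma 6 and §2.3] -/
theorem sqGluing_of_shapedLinkage (hL : Ψ.ShapedLinkage 3) : Ψ.SqGluing := Ψ.sqGluing_of_locatedSurgeries (Ψ.sqLocatedSurgeries_of_shapedLinkage hL)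


/-! ## §3 The end of the square chain -/

/-- **`θ_v(p_c) = 0` FOR EVERY CONNECTED GRAPH WITH A SQUARE SHADOW, a.s. uniqueness of the infinite cluster and LOCAL LINKAGE in the clipped unit blocks**
(Duminil-Copin–Sidoravicius–Tassion's Theorem 1 for an abstract square shadow: every piece of §2 is PROVED in the tree; the instance supplies the purely local,
key-free routing node). [cite: DuminilCopinSidoraviciusTassion2016, Thm. 1 and §2] [cite: BenjaminiSchramm1996, Conj. 4 / Question 3] -/
theorem theta_criticalProb_eq_zero_of_localLinkage (hG : G.Connected) (hU : ∀ p : unitInterval, ∀ᵐ ω ∂(bondPercolation G p), numInfiniteClusters ω ≤ 1)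
    (hL : Ψ.LocalLinkage) (v : V) : theta G v (criticalProbIOf G v) = 0 :=
  Ψ.theta_criticalProb_eq_zero_of_sqGluing hG hU (Ψ.sqGluing_of_localLinkage hL) v

/-- **`θ_v(p_c) = 0` FOR EVERY CONNECTED GRAPH WITH A SQUARE SHADOW, a.s. uniqueness of the infinite cluster and SHAPED LINKAGE (radius `3`)**.
[cite: DuminilCopinSidoraviciusTassion2016, Thm. 1 and §2] [cite: BenjaminiSchramm1996, Conj. 4 / Question 3] -/
theorem theta_criticalProb_eq_zero_of_shapedLinkage (hG : G.Connected) (hU : ∀ p : unitInterval, ∀ᵐ ω ∂(bondPercolation G p), numInfiniteClusters ω ≤ 1)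
    (hL : Ψ.ShapedLinkage 3) (v : V) : theta G v (criticalProbIOf G v) = 0 :=
  Ψ.theta_criticalProb_eq_zero_of_sqGluing hG hU (Ψ.sqGluing_of_shapedLinkage hL) v

end SqShadow

end Summit.CriticalPhenomena.PercolationContinuityZ3.Theorems.Transplant

end
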